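import Mathlib
import HarnessLib
import Literature.Analysis.UnboundedOperators.HeatKernelReversePoincare
import Summits.NavierStokesRegularity.NavierStokesRegularity.Theorems.HalfSpaceWindowDoorCirculationCarryingRigidityGaussExtremalConditions

/-!
# Route `HalfSpaceWindowDoor`, crux `CirculationCarryingRigidity` (stmt-NavierStokesRegularity-25311) —
# the first-order system at the Gaussian-extremal point as GAUSSIAN MOMENT INEQUALITIES: `2 ≤ ⟨‖y‖²⟩_{G₁ω₃} ≤ 6`

LEAD ns-hsw-p1 g7 (cell pub-ns-dss), `--supports stmt-NavierStokesRegularity-25311 --as helper`; sequel of `…GaussExtremalConditions`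
(`gaussExtremal_conditions`: `−Θ ≤ ΔΘ ≤ 0` at `(1, 0)` for `Θ = e^{tΔ}ω₃^W(−1)`).  Folland's formula for the Laplacian of the caloric
extension (`laplacian_heatExtension_eq_integral`: `ΔΘ(1,·)(0) = ∫(‖y‖²/4 − 3/2) G₁(y) ω₃(y) dy`) turns the two differential inequalities
into explicit second-moment bounds for the Gaussian-weighted vertical vorticity of the extremal slice:

* `gaussExtremal_moments` — if W6 fails at constant `C`, there is a closed-hemisphere door-class `W` (constant `C`), `ω := ⟪curl W(−1), e₃⟫ ≥ 0`,
  with `0 < ∫G₁ω`,  `2·∫G₁ω ≤ ∫‖y‖²G₁ω ≤ 6·∫G₁ω`  (`G₁ = heatKernel 1`), and the maximal-inflow identity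
  `ℐ(1;0)[W(−1)] = −2·(4π)^{3/2}·2·∫G₁ω`.  The free Gaussian has `⟨‖y‖²⟩ = 6` and a thin straight vortex column `ω = Φ₀ δ(x_h)` has
  `⟨‖y‖²⟩ = ⟨y₃²⟩ = 2`: the extremal slice's vertical vorticity is, in Gaussian mean about the extremal axis, no more spread than the
  kernel and no more concentrated than a straight filament.
* `hemisphereLiouvilleE3_of_moments` — the corresponding reduction of W6.

WHAT THIS IS NOT: not a statement about Navier–Stokes regularity; door statements concern HYPOTHETICAL blow-up profiles.  No item is
closed by this file.
-/

noncomputable section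

-- the summit and its single sub-problem share the name (CONVENTIONS §1), as in every Theorems file
set_option linter.dupNamespace false

namespace Summit.NavierStokesRegularity.NavierStokesRegularity.Theorems.HalfSpaceWindowDoorCirculationCarryingRigidityGaussExtremalMoments

open MeasureTheory Set Function Filter Topology
open scoped RealInnerProductSpace InnerProductSpace Laplacian
open Literature.Analysis Literature.Analysis.FluidPDE Literature.Analysis.UnboundedOperators
open Summit.NavierStokesRegularity.NavierStokesRegularity.Theses.HalfSpaceWindowDoor
open Summit.NavierStokesRegularity.NavierStokesRegularity.Theorems.HalfSpaceWindowDoorCirculationCarryingRigidityDefs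
open Summit.NavierStokesRegularity.NavierStokesRegularity.Theorems.HalfSpaceWindowDoorCirculationCarryingRigidityReduction
  (circulationCarryingRigidity_of_hemisphereLiouvilleE3)
open Summit.NavierStokesRegularity.NavierStokesRegularity.Theorems.HalfSpaceWindowDoorCirculationCarryingRigidityGaussExtremalConditions
  (gaussExtremal_conditions omega3_continuous_bounded heatKernel_sub_comm)

variable {C : ℝ}

/-- **THE MOMENT INEQUALITIES at the Gaussian-extremal point.**  If some closed-hemisphere door-class profile (Type-I constant `C`) has
`⟪curl v(s₁)(y₁), e₃⟫ > 0` somewhere, there is a closed-hemisphere door-class `W` (constant `C`) with `ω := ⟪curl W(−1), e₃⟫` such that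
`0 < ∫ G₁ ω`, `2∫ G₁ ω ≤ ∫ ‖y‖² G₁(y) ω(y) dy ≤ 6 ∫ G₁ ω`, and `ℐ(1;0)[W(−1)] = −2·(4π)^{3/2}·2·∫ G₁ ω` (`G₁ = heatKernel 1`). -/
theorem gaussExtremal_moments {v : ℝ → EuclideanSpace ℝ (Fin 3) → EuclideanSpace ℝ (Fin 3)} (hv : InDoorClass C v)
    (hsign : SignE3 v) (hpos : ∃ s < 0, ∃ y, 0 < ⟪curl (v s) y, e3⟫) :
    ∃ W : ℝ → EuclideanSpace ℝ (Fin 3) → EuclideanSpace ℝ (Fin 3), InDoorClass C W ∧ SignE3 W ∧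
      0 < ∫ y, heatKernel 1 y * ⟪curl (W (-1)) y, e3⟫ ∧
      2 * ∫ y, heatKernel 1 y * ⟪curl (W (-1)) y, e3⟫ ≤ ∫ y, ‖y‖ ^ 2 * heatKernel 1 y * ⟪curl (W (-1)) y, e3⟫ ∧
      ∫ y, ‖y‖ ^ 2 * heatKernel 1 y * ⟪curl (W (-1)) y, e3⟫ ≤ 6 * ∫ y, heatKernel 1 y * ⟪curl (W (-1)) y, e3⟫ ∧
      gaussInflow 1 0 (W (-1)) = -2 * ((4 * Real.pi) ^ ((3 : ℝ) / 2) * 2 * ∫ y, heatKernel 1 y * ⟪curl (W (-1)) y, e3⟫) := by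
  obtain ⟨W, hW, hWs, h0, -, -, hlap, hsc, hI⟩ := gaussExtremal_conditions hv hsign hpos
  set ω : EuclideanSpace ℝ (Fin 3) → ℝ := fun x => ⟪curl (W (-1)) x, e3⟫ with hω
  obtain ⟨hωc', B, hωB'⟩ := omega3_continuous_bounded hW (by norm_num : (-1 : ℝ) < 0)
  have hωc : Continuous ω := hωc'
  have hωB : ∀ x, ‖ω x‖ ≤ B := hωB'
  -- `Θ(1,0)` as a Gaussian integral
  have hΘ : heatExtension ω 1 0 = ∫ y, heatKernel 1 y * ω y := by
    rw [heatExtension_eq_integral_mul]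
    congr 1; funext z; rw [heatKernel_sub_comm, sub_zero]
  -- `ΔΘ(1,·)(0)` by Folland's formula
  have hΔ : (Δ (heatExtension ω 1)) 0 = ∫ y, (‖y‖ ^ 2 / 4 - 3 / 2) * (heatKernel 1 y * ω y) := by
    rw [laplacian_heatExtension_eq_integral one_pos (memLp_top_of_continuous_of_bound hωc hωB) le_top 0]
    congr 1; funext y
    rw [heatKernel_sub_comm, sub_zero, zero_sub, norm_neg, finrank_euclideanSpace_fin, smul_eq_mul]
    push_cast
    ring
  -- integrability of the two moments
  have hint0 : Integrable (fun y : EuclideanSpace ℝ (Fin 3) => heatKernel 1 y * ω y) := by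
    have h := ((integrable_heatKernel_holds (E := EuclideanSpace ℝ (Fin 3)) one_pos).bdd_mul hωc.aestronglyMeasurable
      (ae_of_all _ fun x => hωB x))
    exact h.congr (ae_of_all _ fun x => by simp [mul_comm])
  have hint2 : Integrable (fun y : EuclideanSpace ℝ (Fin 3) => ‖y‖ ^ 2 * heatKernel 1 y * ω y) := by
    have h := ((integrable_norm_sq_mul_heatKernel (E := EuclideanSpace ℝ (Fin 3)) one_pos).bdd_mul hωc.aestronglyMeasurable
      (ae_of_all _ fun x => hωB x))
    exact h.congr (ae_of_all _ fun x => by simp only; ring)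
  -- split Folland's integral
  have hsplit : ∫ y, (‖y‖ ^ 2 / 4 - 3 / 2) * (heatKernel 1 y * ω y) =
      (1 / 4) * (∫ y, ‖y‖ ^ 2 * heatKernel 1 y * ω y) - (3 / 2) * (∫ y, heatKernel 1 y * ω y) := by
    have heq : (fun y : EuclideanSpace ℝ (Fin 3) => (‖y‖ ^ 2 / 4 - 3 / 2) * (heatKernel 1 y * ω y)) =
        fun y => (1 / 4) * (‖y‖ ^ 2 * heatKernel 1 y * ω y) - (3 / 2) * (heatKernel 1 y * ω y) := by
      funext y; ring
    rw [heq, integral_sub (hint2.const_mul _) (hint0.const_mul _), integral_const_mul, integral_const_mul]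
  rw [hΘ] at h0 hsc hI
  rw [hΔ, hsplit] at hlap hsc
  refine ⟨W, hW, hWs, h0, ?_, ?_, hI⟩
  · linarith
  · linarith

/-- **REDUCTION: W6 from the moment inequalities.**  If no closed-hemisphere door-class profile `W` has, at `(t, τ, y₀) = (1, −1, 0)`,
positive Gaussian vertical vorticity with `2 ≤ ⟨‖y‖²⟩_{G₁ω₃} ≤ 6` and the maximal-inflow identity, then `HemisphereLiouvilleE3` holds. -/
theorem hemisphereLiouvilleE3_of_moments
    (h : ∀ (C : ℝ) (W : ℝ → EuclideanSpace ℝ (Fin 3) → EuclideanSpace ℝ (Fin 3)), InDoorClass C W → SignE3 W →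
      0 < ∫ y, heatKernel 1 y * ⟪curl (W (-1)) y, e3⟫ →
      2 * ∫ y, heatKernel 1 y * ⟪curl (W (-1)) y, e3⟫ ≤ ∫ y, ‖y‖ ^ 2 * heatKernel 1 y * ⟪curl (W (-1)) y, e3⟫ →
      ∫ y, ‖y‖ ^ 2 * heatKernel 1 y * ⟪curl (W (-1)) y, e3⟫ ≤ 6 * ∫ y, heatKernel 1 y * ⟪curl (W (-1)) y, e3⟫ →
      gaussInflow 1 0 (W (-1)) = -2 * ((4 * Real.pi) ^ ((3 : ℝ) / 2) * 2 * ∫ y, heatKernel 1 y * ⟪curl (W (-1)) y, e3⟫) → False) :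
    HemisphereLiouvilleE3 := by
  intro C v hrate hcont hmild hdiv hsign s hs y
  by_contra hne
  have hpos : 0 < ⟪curl (v s) y, e3⟫ := lt_of_le_of_ne (hsign s hs y) (Ne.symm hne)
  obtain ⟨W, hW, hWs, h0, h1, h2, h3⟩ := gaussExtremal_moments (C := C) ⟨hrate, hcont, hmild, hdiv⟩ hsign ⟨s, hs, y, hpos⟩
  exact h C W hW hWs h0 h1 h2 h3

/-- **The crux from the moment inequalities** (composition with the landed plumbing `stub_rotate`). -/
theorem circulationCarryingRigidity_of_moments
    (h : ∀ (C : ℝ) (W : ℝ → EuclideanSpace ℝ (Fin 3) → EuclideanSpace ℝ (Fin 3)), InDoorClass C W → SignE3 W →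
      0 < ∫ y, heatKernel 1 y * ⟪curl (W (-1)) y, e3⟫ →
      2 * ∫ y, heatKernel 1 y * ⟪curl (W (-1)) y, e3⟫ ≤ ∫ y, ‖y‖ ^ 2 * heatKernel 1 y * ⟪curl (W (-1)) y, e3⟫ →
      ∫ y, ‖y‖ ^ 2 * heatKernel 1 y * ⟪curl (W (-1)) y, e3⟫ ≤ 6 * ∫ y, heatKernel 1 y * ⟪curl (W (-1)) y, e3⟫ →
      gaussInflow 1 0 (W (-1)) = -2 * ((4 * Real.pi) ^ ((3 : ℝ) / 2) * 2 * ∫ y, heatKernel 1 y * ⟪curl (W (-1)) y, e3⟫) → False) :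
    CirculationCarryingRigidity :=
  circulationCarryingRigidity_of_hemisphereLiouvilleE3 (hemisphereLiouvilleE3_of_moments h)

end Summit.NavierStokesRegularity.NavierStokesRegularity.Theorems.HalfSpaceWindowDoorCirculationCarryingRigidityGaussExtremalMoments

end
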